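import Summits.BirchSwinnertonDyer.BirchSwinnertonDyer.Theorems.ThetaPartnerAtTwoSignedKatoUpToAtTwoLayerSideNoPTOfCore
import Literature.NumberTheory.EllipticCurves.Sprung2012.ColemanPairUniqueProofs
import Literature.NumberTheory.EllipticCurves.Sprung2017.SharpFlatPAdicLFunctionUniqueProofs
import Literature.NumberTheory.EllipticCurves.IwasawaAlgebraCharIdealProofs
import Summits.BirchSwinnertonDyer.Rank1Residual.Supersingular.SprungPollackConsistency
import Summits.BirchSwinnertonDyer.BirchSwinnertonDyer.Theorems.AdditiveBranchIMCGordTwoRankZeroLambdaAdic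
import Summits.BirchSwinnertonDyer.BirchSwinnertonDyer.Theorems.PrintX11aUpperNonSurjThreeMultDivisibilityAtOfConjA
import HarnessLib

/-!
# Route `ThetaPartnerAtTwo` (TP2), crux K3 `SignedKatoDivisibilityUpToAtTwo` (stmt-BirchSwinnertonDyer-20308) / K3P′
# `SignedKatoDivisibilityUpToAtTwoOfPub` (stmt-BirchSwinnertonDyer-25631), line `colemanrat` v10 → v11:
# «MAZUR–TATE VALUES ⇒ EXPLICIT RECIPROCITY IN ♭-COLEMAN CURRENCY» — the (R4) algebra of the CORE socket, in the kernel

Lead prover `bsd-wall-tp2-p2x` g6 (cell `bsd-wall`). HONEST FRAMING: theorems only (no definition, no named fact, no instance,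
no `sorry`); closes no item by itself; K3 / K3P′ are NOT settled and BSD is NOT proved by any of this.

## What is here

Skeleton v10 of the line has ONE published-input stub, CORE = `stub_katoZetaErlTwo` = the hypothesis `hcore` of
`SignedKatoOffTwo.NoPTOfCore.layerSideNoPTTwo_of_core` (p615686): Kato's `2`-adic Euler-system class (ES) plus the explicit reciprocity
law in ♭-COLEMAN / LENGTH currency (ERL♭). The socket memo `Cruxes/…/W3G5-CORE-SOCKET.md` §3 splits the print content of (ERL♭) as
(R1) Bloch–Kato reciprocity + (R2) Kato Thm. 12.5 + (R3) Honda log-values + (R4) ALGEBRA «from `P_n(z_Kato) ≡` Mazur–Tate element to the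
Coleman pair». This file proves (R4) in the kernel and re-sockets CORE on the PRINTED SHAPE of Kurihara / Kobayashi / Otsuki:
§1 `exists_eq_omega_mul_of_C_pow_mul_eq` (`p^M x ∈ ω_n Λ ⇒ x ∈ ω_n Λ`); §2 `isChromaticLimit_of_isSprungPair_of_mtValues` (any `p`,
any trace: the Mazur–Tate value congruences `Θ_n ≡ μ·r·θ_n (mod ω_n)` + a Sprung pair give an INTEGRAL chromatic limit); §3
`C_mul_coleman_eq_of_mtValues` (`p ∣ a_p`: a Coleman pair of a functional with Mazur–Tate values is `μ·r·(L♯, L♭)`, by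
`Sprung2017.IsChromaticLimit.unique`); §4 lengths at height-one `𝔭 ∌ p` (via `Summit.BirchSwinnertonDyer.Rank1Residual.X11b.MultFineMu.lengthAt_quotient_span_mul_eq_of_not_mem`); §5 (`p = 2`, `a₂ = 0`, Pollack pair via `isSprungPair_zero_iff`)
`lengthAt_flat_eq_of_isPollackPair_of_mtValues`; §6 `core_of_mtvCore` — **CORE ⟸ MTV-CORE**, the registered stub with (ERL♭) REPLACED by
(MTV) «`P_{n,d_n}(col₀ s) ≡ μ·r·θ_n(f) (mod ω_n)` in `Λ ⊗ ℚ₂`, `μ ∉ 𝔭`, `r ∈ ℚˣ`» = the printed sentence «the image of Kato's zeta element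
under `P_{n,c_n}` is the Mazur–Tate modular element» (Kobayashi 2003 (8.23)–(8.26) and proof of Thm. 6.3; Kurihara 2002 §3; Sprung 2012
Prop. 6.3–6.5; at `p = 2`, integrally: Otsuki 2009 Thm. 3.6/4.1, Kato's `(c,d)`-elements, `μ = μ_{c,d}`, `r` the period ratio).

References: [Kobayashi2003] (8.23), Prop. 8.25–8.26, Thm. 6.3; [Sprung2012] Def. 3.1, Prop. 5.7, Def. 5.9, Prop. 6.3–6.5; [Sprung2017]
Thm. 1.12, Cor. 4.4; [Pollack2003] Prop. 6.18; [Kato2004Asterisque] Thm. 12.5, §13.9–13.14; [Otsuki2009] Thm. 3.6/4.1; [Washington1997] §13.2.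
-/

set_option autoImplicit false
-- the Theorems namespace of this sub repeats the summit name by design (D-0017 nested layout)
set_option linter.dupNamespace false

noncomputable section

open scoped Classical MatrixGroups ModularForm NumberField

open CongruenceSubgroup WeierstrassCurve Field IsDedekindDomain NumberField Polynomial
  Literature.NumberTheory.GaloisRepresentations
  Literature.NumberTheory.EllipticCurves Literature.NumberTheory.EllipticCurves.ModularForms
  Literature.NumberTheory.EllipticCurves.Module Literature.NumberTheory.EllipticCurves.Rank1Residual
  Literature.NumberTheory.EllipticCurves.Kobayashi2003 Literature.NumberTheory.EllipticCurves.Kato2004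
  Literature.NumberTheory.EllipticCurves.Kato2004.EulerSystemValues Literature.NumberTheory.EllipticCurves.GreenbergSelmer
  Literature.NumberTheory.EllipticCurves.Sprung2012 Literature.NumberTheory.EllipticCurves.Sprung2017
  ZpExtension Summit.BirchSwinnertonDyer.Rank1Residual.Supersingular

namespace Summit.BirchSwinnertonDyer.BirchSwinnertonDyer.Theorems.SignedKatoOffTwo.MTValues

/-! ## §1 `p`-powers are removable modulo `ω_n` -/

section Generic

variable {p : ℕ} [hp : Fact p.Prime]

/-- `ι(C n) = C n` for `n ∈ ℕ`. [folklore] -/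
theorem iota_C_natCast (n : ℕ) : iwasawaToPowerSeries p (PowerSeries.C (n : ℤ_[p])) = PowerSeries.C (n : ℚ_[p]) := by
  rw [AdditiveBranchIMCGordTwoRankZeroLambdaAdic.iwasawaToPowerSeries_C, PadicInt.coe_natCast]
/-- `ι(C n) = C n` for `n ∈ ℤ`. [folklore] -/
theorem iota_C_intCast (n : ℤ) : iwasawaToPowerSeries p (PowerSeries.C (n : ℤ_[p])) = PowerSeries.C (n : ℚ_[p]) := by
  rw [AdditiveBranchIMCGordTwoRankZeroLambdaAdic.iwasawaToPowerSeries_C, PadicInt.coe_intCast]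
/-- **`p^M · x ∈ ω_n Λ ⇒ x ∈ ω_n Λ`** in `Λ = ℤ_p⟦T⟧` (`ω_n = (1+T)^{pⁿ} − 1` is prime to `p`): the public form of the first step of the
uniqueness of Sprung's pair, read off `IsCongrModOmega.exists_mul_sub_eq` for the congruence `0 ≡ 1·x (mod ω_n)`.
[cite: Sprung2017, Thm. 1.12 (uniqueness)] -/
theorem exists_eq_omega_mul_of_C_pow_mul_eq {n M : ℕ} {x r : IwasawaAlgebra p}
    (h : PowerSeries.C ((p : ℤ_[p]) ^ M) * x =
      ((cyclotomicOmega p n).map (Int.castRingHom ℤ_[p]) : PowerSeries ℤ_[p]) * r) :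
    ∃ r' : IwasawaAlgebra p, x = ((cyclotomicOmega p n).map (Int.castRingHom ℤ_[p]) : PowerSeries ℤ_[p]) * r' := by
  have hone : (((1 : ℤ[X]).map (Int.castRingHom ℤ_[p]) : ℤ_[p][X]) : PowerSeries ℤ_[p]) = 1 := by
    rw [Polynomial.map_one, Polynomial.coe_one]
  have hzero : (((0 : ℚ[X]).map (algebraMap ℚ ℚ_[p]) : ℚ_[p][X]) : PowerSeries ℚ_[p]) = 0 := by
    rw [Polynomial.map_zero, Polynomial.coe_zero]
  have h₁ : IsCongrModOmega p n 0 1 x := by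
    refine ⟨M, -r, ?_⟩
    rw [hzero, hone, one_mul, zero_sub, mul_neg, mul_neg, map_neg, ← h, map_mul,
      AdditiveBranchIMCGordTwoRankZeroLambdaAdic.iwasawaToPowerSeries_C, PadicInt.coe_pow, PadicInt.coe_natCast]
  have h₂ : IsCongrModOmega p n 0 1 0 := by
    refine ⟨0, 0, ?_⟩
    rw [hzero, hone, one_mul, map_zero, sub_zero, mul_zero, mul_zero, map_zero]
  obtain ⟨r', hr'⟩ := h₁.exists_mul_sub_eq h₂
  rw [hone, one_mul, sub_zero] at hr'
  exact ⟨r', hr'⟩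

/-! ## §2 Mazur–Tate values ⇒ chromatic limit (any `p`, any trace `ap`) -/

/-- Scaling a chromatic limit by a constant `c ∈ ℤ_p`. [cite: Sprung2017, Cor. 4.4] -/
theorem isChromaticLimit_C_mul {ap : ℤ} {Θ : ℕ → ℤ_[p][X]} {Cs Cf : IwasawaAlgebra p} (c : ℤ_[p])
    (h : IsChromaticLimit p ap Θ Cs Cf) :
    IsChromaticLimit p ap (fun n ↦ Polynomial.C c * Θ n) (PowerSeries.C c * Cs) (PowerSeries.C c * Cf) := by
  intro m
  obtain ⟨Q, hQ⟩ := h m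
  refine ⟨PowerSeries.C c * Q, ?_⟩
  rw [Polynomial.coe_mul, Polynomial.coe_C]
  linear_combination (PowerSeries.C c) * hQ

/-- **Mazur–Tate values ⇒ chromatic limit.** If `(L♯, L♭)` is a Sprung pair of `f` for the trace `ap` (`θ_n ≡ −(u_n L♯ + v_n L♭)
(mod ω_n)` in `Λ ⊗ ℚ_p`) and `Θ_n ∈ ℤ_p[T]` satisfies `Θ_n ≡ μ·r·θ_n (mod ω_n)` in `Λ ⊗ ℚ_p` (`μ ∈ Λ`, `r ∈ ℚ`), then
`(μ·r.num·L♯, μ·r.num·L♭)` is a chromatic limit of `r.den·Θ` — INTEGRALLY, the `p`-powers being removed by §1.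
[cite: Sprung2017, Cor. 4.4 and Thm. 1.12] [cite: Sprung2012, Prop. 6.3–6.5 (p. 1497)] -/
theorem isChromaticLimit_of_isSprungPair_of_mtValues {N : ℕ} (f : CuspForm (Gamma0 N) 2) {ap : ℤ}
    {Lsharp Lflat : IwasawaAlgebra p} (hSP : IsSprungPair f p ap Lsharp Lflat)
    {Θ : ℕ → ℤ_[p][X]} (μ : IwasawaAlgebra p) (r : ℚ)
    (hMT : ∀ n : ℕ, ∃ (m : ℕ) (q : IwasawaAlgebra p),
      PowerSeries.C ((p : ℚ_[p]) ^ m) *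
          (iwasawaToPowerSeries p (Θ n : PowerSeries ℤ_[p]) -
            iwasawaToPowerSeries p μ * PowerSeries.C ((r : ℚ) : ℚ_[p]) *
              ((mazurTateElement f p n).map (algebraMap ℚ ℚ_[p]) : PowerSeries ℚ_[p])) =
        iwasawaToPowerSeries p (((cyclotomicOmega p n).map (Int.castRingHom ℤ_[p]) : PowerSeries ℤ_[p]) * q)) :
    IsChromaticLimit p ap (fun n ↦ Polynomial.C ((r.den : ℕ) : ℤ_[p]) * Θ n)
      (μ * PowerSeries.C ((r.num : ℤ) : ℤ_[p]) * Lsharp) (μ * PowerSeries.C ((r.num : ℤ) : ℤ_[p]) * Lflat) := by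
  intro n
  obtain ⟨m₁, q₁, e₁⟩ := hSP n
  obtain ⟨m₂, q₂, e₂⟩ := hMT n
  have hneg : (((-1 : ℤ[X]).map (Int.castRingHom ℤ_[p]) : ℤ_[p][X]) : PowerSeries ℤ_[p]) = -1 := by
    rw [Polynomial.map_neg, Polynomial.map_one, Polynomial.coe_neg, Polynomial.coe_one]
  rw [hneg] at e₁
  -- the rational constant: `den · r = num` in `ℚ_p`
  have hr : (PowerSeries.C ((r.den : ℕ) : ℚ_[p]) : PowerSeries ℚ_[p]) * PowerSeries.C ((r : ℚ) : ℚ_[p]) =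
      PowerSeries.C ((r.num : ℤ) : ℚ_[p]) := by
    rw [← map_mul]
    congr 1
    have h := congrArg (fun q : ℚ ↦ (q : ℚ_[p])) (Rat.den_mul_eq_num r)
    push_cast at h
    exact h
  -- the integral element whose `p^{m₁+m₂}`-multiple lies in `ω_n Λ`
  have key : iwasawaToPowerSeries p (PowerSeries.C ((p : ℤ_[p]) ^ (m₁ + m₂)) *
      (((Polynomial.C ((r.den : ℕ) : ℤ_[p]) * Θ n : ℤ_[p][X]) : PowerSeries ℤ_[p]) +
        (toIwasawa p (sharpPoly ap p n) * (μ * PowerSeries.C ((r.num : ℤ) : ℤ_[p]) * Lsharp) +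
          toIwasawa p (flatPoly ap p n) * (μ * PowerSeries.C ((r.num : ℤ) : ℤ_[p]) * Lflat)))) =
      iwasawaToPowerSeries p (((cyclotomicOmega p n).map (Int.castRingHom ℤ_[p]) : PowerSeries ℤ_[p]) *
        (PowerSeries.C ((p : ℤ_[p]) ^ m₁) * PowerSeries.C ((r.den : ℕ) : ℤ_[p]) * q₂ +
          PowerSeries.C ((p : ℤ_[p]) ^ m₂) * μ * PowerSeries.C ((r.num : ℤ) : ℤ_[p]) * q₁)) := by
    simp only [map_mul, map_add, map_neg, map_one, iota_C_natCast, iota_C_intCast,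
      Polynomial.coe_mul, Polynomial.coe_C, map_pow] at e₁ e₂ ⊢
    linear_combination (PowerSeries.C (p : ℚ_[p]) ^ m₁ * PowerSeries.C ((r.den : ℕ) : ℚ_[p])) * e₂ +
      (PowerSeries.C (p : ℚ_[p]) ^ m₂ * iwasawaToPowerSeries p μ * PowerSeries.C ((r.num : ℤ) : ℚ_[p])) * e₁ +
      (PowerSeries.C (p : ℚ_[p]) ^ m₁ * PowerSeries.C (p : ℚ_[p]) ^ m₂ * iwasawaToPowerSeries p μ *
        ((mazurTateElement f p n).map (algebraMap ℚ ℚ_[p]) : PowerSeries ℚ_[p])) * hr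
  exact exists_eq_omega_mul_of_C_pow_mul_eq (iwasawaToPowerSeries_injective p key)

/-! ## §3 Coleman pairs with Mazur–Tate values (`p ∣ a_p`) -/

section Coleman

variable {E : Type} [Field E] [Algebra ℚ E] (κ : ZpExtension ℚ p) (ι : AlgebraicClosure ℚ →ₐ[ℚ] AlgebraicClosure E)
  (W : WeierstrassCurve ℚ)

/-- **The Coleman pair of a functional with Mazur–Tate values** (`p ∣ a_p`): if `z` (a functional on `E(K_∞·K_v)`) has a Coleman
pair `(L♯', L♭')` w.r.t. `(g, d)` and its pairing values satisfy `P_{n,d_n}(z) ≡ μ·r·θ_n(f) (mod ω_n)` in `Λ ⊗ ℚ_p` for all `n`, where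
`(L♯, L♭)` is a Sprung pair of `f`, then `r.den·(L♯', L♭') = μ·r.num·(L♯, L♭)` (two chromatic limits of `r.den·P_{n,d_n}(z)`;
`Sprung2017.IsChromaticLimit.unique`) — the algebra behind «`Col(z_Kato) = (L♯_p, L♭_p)` ⟸ `P_{n,c_n}(z_Kato) = θ_n`».
[cite: Sprung2012, Prop. 5.7, Def. 5.9 and Prop. 6.3–6.5 (pp. 1494–1497)] [cite: Kobayashi2003, proof of Thm. 6.3 (p. 25)] -/
theorem C_mul_coleman_eq_of_mtValues {ap : ℤ} (hap : (p : ℤ) ∣ ap) {N : ℕ} (f : CuspForm (Gamma0 N) 2)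
    {g : absoluteGaloisGroup E} {d : ℕ → localPoints W E} {z : localTowerPointsOfEmb κ ι W →+ ℤ_[p]}
    {Lsharp' Lflat' : IwasawaAlgebra p} (hcol : IsColemanPair κ ι W ap g d z Lsharp' Lflat')
    {Lsharp Lflat : IwasawaAlgebra p} (hSP : IsSprungPair f p ap Lsharp Lflat)
    (μ : IwasawaAlgebra p) (r : ℚ)
    (hMT : ∀ n : ℕ, ∃ (m : ℕ) (q : IwasawaAlgebra p),
      PowerSeries.C ((p : ℚ_[p]) ^ m) *
          (iwasawaToPowerSeries p (pairingSum W (localTowerPointsOfEmb κ ι W) g n (d n) z) -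
            iwasawaToPowerSeries p μ * PowerSeries.C ((r : ℚ) : ℚ_[p]) *
              ((mazurTateElement f p n).map (algebraMap ℚ ℚ_[p]) : PowerSeries ℚ_[p])) =
        iwasawaToPowerSeries p (((cyclotomicOmega p n).map (Int.castRingHom ℤ_[p]) : PowerSeries ℤ_[p]) * q)) :
    PowerSeries.C ((r.den : ℕ) : ℤ_[p]) * Lsharp' = μ * PowerSeries.C ((r.num : ℤ) : ℤ_[p]) * Lsharp ∧
      PowerSeries.C ((r.den : ℕ) : ℤ_[p]) * Lflat' = μ * PowerSeries.C ((r.num : ℤ) : ℤ_[p]) * Lflat := by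
  have h1 := isChromaticLimit_C_mul ((r.den : ℕ) : ℤ_[p]) (isChromaticLimit_of_isColemanPair κ ι W hcol)
  have h2 : IsChromaticLimit p ap (fun n ↦ Polynomial.C ((r.den : ℕ) : ℤ_[p]) * colemanTheta κ ι W g d z n)
      (μ * PowerSeries.C ((r.num : ℤ) : ℤ_[p]) * Lsharp) (μ * PowerSeries.C ((r.num : ℤ) : ℤ_[p]) * Lflat) :=
    isChromaticLimit_of_isSprungPair_of_mtValues f hSP μ r fun n ↦ by
      rw [coe_colemanTheta]
      exact hMT n
  exact IsChromaticLimit.unique hap h1 h2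

end Coleman

/-! ## §4 Lengths at height-one primes `𝔭 ∌ p` -/

/-- **Length bookkeeping**: from `C(den)·L♭' = μ·C(num)·L♭` with `den, num ≠ 0`, `μ ∉ 𝔭` and `p ∉ 𝔭`:
`ℓ_𝔭(Λ/(L♭')) = ℓ_𝔭(Λ/(L♭))`. [cite: Washington1997, §13.2] -/
theorem lengthAt_quotient_span_eq_of_C_mul_eq {den : ℕ} {num : ℤ} (hden : den ≠ 0) (hnum : num ≠ 0)
    {μ L L' : IwasawaAlgebra p} (𝔭 : PrimeSpectrum (IwasawaAlgebra p))
    (hp𝔭 : PowerSeries.C (p : ℤ_[p]) ∉ 𝔭.asIdeal) (hμ : μ ∉ 𝔭.asIdeal)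
    (heq : PowerSeries.C ((den : ℕ) : ℤ_[p]) * L' = μ * PowerSeries.C ((num : ℤ) : ℤ_[p]) * L) :
    lengthAt (IwasawaAlgebra p) (IwasawaAlgebra p ⧸ Ideal.span {L'}) 𝔭 =
      lengthAt (IwasawaAlgebra p) (IwasawaAlgebra p ⧸ Ideal.span {L}) 𝔭 := by
  have hden' : ((den : ℕ) : ℤ_[p]) ≠ 0 := by exact_mod_cast hden
  have hnum' : ((num : ℤ) : ℤ_[p]) ≠ 0 := by exact_mod_cast hnum
  rw [← Summit.BirchSwinnertonDyer.Rank1Residual.X11b.MultFineMu.lengthAt_quotient_span_mul_eq_of_not_mem L' 𝔭 (Summit.BirchSwinnertonDyer.Rank1Residual.X11b.MultFineMu.C_not_mem_of_C_p_not_mem hden' 𝔭 hp𝔭),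
    heq, mul_assoc, Summit.BirchSwinnertonDyer.Rank1Residual.X11b.MultFineMu.lengthAt_quotient_span_mul_eq_of_not_mem _ 𝔭 hμ,
    Summit.BirchSwinnertonDyer.Rank1Residual.X11b.MultFineMu.lengthAt_quotient_span_mul_eq_of_not_mem _ 𝔭 (Summit.BirchSwinnertonDyer.Rank1Residual.X11b.MultFineMu.C_not_mem_of_C_p_not_mem hnum' 𝔭 hp𝔭)]

end Generic

/-! ## §5 `p = 2`, `a₂ = 0`: the (ERL♭) inequality from Mazur–Tate values against a Pollack pair -/

section Two

variable {E : Type} [Field E] [Algebra ℚ E] (κ : ZpExtension ℚ 2) (ι : AlgebraicClosure ℚ →ₐ[ℚ] AlgebraicClosure E)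
  (W : WeierstrassCurve ℚ)

/-- **(ERL♭) from Mazur–Tate values, at `p = 2`, `a₂ = 0`.** For a Pollack pair `(L⁺, L⁻)` of `f` at `2` (a Sprung pair for trace
`0` by `isSprungPair_zero_iff`; `kobayashiL 1 L⁺ L⁻ = L⁻ = L♭`), a prime `𝔭 ∌ 2` of `Λ`, and a functional `z` on `E(K_∞·K_v)` with
`P_{n,d_n}(z) ≡ μ·r·θ_n(f) (mod ω_n)` in `Λ ⊗ ℚ₂` for all `n` (`μ ∉ 𝔭`, `r ≠ 0`): EVERY Coleman pair `(L♯', L♭')` of `z` w.r.t. `(g, d)`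
has `ℓ_𝔭(Λ/(L♭')) = ℓ_𝔭(Λ/(kobayashiL 1 L⁺ L⁻))` — the (ERL♭) clause of the K3 CORE socket. [cite: Sprung2012, Prop. 5.7 and Def. 5.9]
[cite: Kobayashi2003, Thm. 6.3 and its proof (pp. 11, 25)] [cite: Pollack2003, Prop. 6.18] -/
theorem lengthAt_flat_eq_of_isPollackPair_of_mtValues {N : ℕ} [NeZero N] (f : CuspForm (Gamma0 N) 2)
    {Lplus Lminus : IwasawaAlgebra 2} (hPP : IsPollackPair f 2 Lplus Lminus)
    (𝔭 : PrimeSpectrum (IwasawaAlgebra 2)) (hp𝔭 : PowerSeries.C (2 : ℤ_[2]) ∉ 𝔭.asIdeal)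
    {g : absoluteGaloisGroup E} {d : ℕ → localPoints W E} {z : localTowerPointsOfEmb κ ι W →+ ℤ_[2]}
    {μ : IwasawaAlgebra 2} {r : ℚ} (hμ : μ ∉ 𝔭.asIdeal) (hr : r ≠ 0)
    (hMT : ∀ n : ℕ, ∃ (m : ℕ) (q : IwasawaAlgebra 2),
      PowerSeries.C ((2 : ℚ_[2]) ^ m) *
          (iwasawaToPowerSeries 2 (pairingSum W (localTowerPointsOfEmb κ ι W) g n (d n) z) -
            iwasawaToPowerSeries 2 μ * PowerSeries.C ((r : ℚ) : ℚ_[2]) *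
              ((mazurTateElement f 2 n).map (algebraMap ℚ ℚ_[2]) : PowerSeries ℚ_[2])) =
        iwasawaToPowerSeries 2 (((cyclotomicOmega 2 n).map (Int.castRingHom ℤ_[2]) : PowerSeries ℤ_[2]) * q))
    {Lsharp' Lflat' : IwasawaAlgebra 2} (hcol : IsColemanPair κ ι W 0 g d z Lsharp' Lflat') :
    lengthAt (IwasawaAlgebra 2) (IwasawaAlgebra 2 ⧸ Ideal.span {Lflat'}) 𝔭 =
      lengthAt (IwasawaAlgebra 2) (IwasawaAlgebra 2 ⧸ Ideal.span {kobayashiL 1 Lplus Lminus}) 𝔭 := by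
  have hSP : IsSprungPair f 2 0 Lplus Lminus := (isSprungPair_zero_iff f 2 Lplus Lminus).mpr ⟨hPP.2.2.1, hPP.2.2.2⟩
  have hMT' : ∀ n : ℕ, ∃ (m : ℕ) (q : IwasawaAlgebra 2),
      PowerSeries.C (((2 : ℕ) : ℚ_[2]) ^ m) *
          (iwasawaToPowerSeries 2 (pairingSum W (localTowerPointsOfEmb κ ι W) g n (d n) z) -
            iwasawaToPowerSeries 2 μ * PowerSeries.C ((r : ℚ) : ℚ_[2]) *
              ((mazurTateElement f 2 n).map (algebraMap ℚ ℚ_[2]) : PowerSeries ℚ_[2])) =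
        iwasawaToPowerSeries 2 (((cyclotomicOmega 2 n).map (Int.castRingHom ℤ_[2]) : PowerSeries ℤ_[2]) * q) := by
    simpa only [Nat.cast_ofNat] using hMT
  obtain ⟨-, hflat⟩ := C_mul_coleman_eq_of_mtValues κ ι W (dvd_zero (2 : ℤ)) f hcol hSP μ r hMT'
  have hp𝔭' : PowerSeries.C ((2 : ℕ) : ℤ_[2]) ∉ 𝔭.asIdeal := by simpa only [Nat.cast_ofNat] using hp𝔭
  have h := lengthAt_quotient_span_eq_of_C_mul_eq (p := 2) r.den_nz (Rat.num_ne_zero.mpr hr) 𝔭 hp𝔭' hμ hflat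
  rw [h, kobayashiL, if_pos rfl]

end Two

/-! ## §6 CORE ⟸ MTV-CORE: the K3 socket re-stated on the printed shape «`P_n(z_Kato) ≡ μ·r·θ_n (mod ω_n)`» -/

section Core

/-- **CORE ⟸ MTV-CORE.** Hypothesis `hmtv` (the new published-input stub `stub_katoMazurTateValuesTwo` of skeleton `colemanrat` v11,
spelled inline): the registered CORE (`stub_katoZetaErlTwo`, = `hcore` of `NoPTOfCore.layerSideNoPTTwo_of_core`) with its last conjunct
(ERL♭) «every Coleman pair `(L♯', L♭')` of `col₀ s` has `ℓ_𝔭(Λ/(L♭')) ≤ ℓ_𝔭(Λ/(L♭))`» REPLACED by the MAZUR–TATE VALUE congruences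
(MTV) «there are `μ ∈ Λ` with `μ ∉ 𝔭` and `r ∈ ℚˣ` such that `P_{n,d_n}(col₀ s) ≡ μ·r·θ_n(f) (mod ω_n)` in `Λ ⊗ ℚ₂` for every `n`»
— the PRINTED SHAPE of the explicit reciprocity law for Kato's zeta element read through the cup-product pairing with a Honda system:
`P_{n,c_n}(z) = Σ_σ (c_n^σ, z)_n σ` (Kobayashi (8.23)), `P_{n,c_n}(z_Kato) =` the Mazur–Tate modular element (Kobayashi Prop. 8.25–8.26 +
Kato Thm. 12.5, proof of Thm. 6.3 p. 25; Kurihara 2002 §3; Sprung 2012 Prop. 6.3–6.5; integrally and at `p = 2`: Otsuki 2009 Thm. 3.6/4.1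
for Kato's `(c,d)`-elements, `μ = μ_{c,d}`, `r` the period ratio). Conclusion: CORE VERBATIM. Proof: §5 at the Coleman pair in hand.
CONDITIONAL on `hmtv` only; closes nothing by itself. [cite: Kobayashi2003, (8.23) (p. 18), Prop. 8.25–8.26 and proof of Thm. 6.3 (pp. 24–25)]
[cite: Sprung2012, Def. 3.1 (p. 1489), Prop. 5.7, Def. 5.9 (p. 1495), Prop. 6.3–6.5] [cite: Kato2004Asterisque, Thm. 12.5 (p. 222), §13.9–13.14]
[cite: Otsuki2009, Thm. 3.6 and Thm. 4.1 (p. 277)] [cite: Pollack2003, Prop. 6.18] -/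
theorem core_of_mtvCore
    (hmtv :
      ∀ (v : HeightOneSpectrum (𝓞 ℚ)), ((2 : ℕ) : 𝓞 ℚ) ∈ v.asIdeal →
      ∀ (W : WeierstrassCurve ℚ) [W.IsElliptic] [W.IsGloballyMinimal],
        ¬ W.HasCM → W.analyticRank = 0 → GoodSS W 2 → W.frobeniusTrace 2 = 0 →
        ∀ (κ : ZpExtension ℚ 2) (γ : Field.absoluteGaloisGroup ℚ) (hκ : κ.IsCyclotomic),
          κ.IsTopGenerator γ → IsCyclotomicVariable 2 γ →
          ∀ [NeZero (W.conductorNorm ℤ)] (f : CuspForm (Gamma0 (W.conductorNorm ℤ)) 2),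
            IsNewformOf W f → ∀ (ϖ : ℚ), (ϖ : ℝ) * W.realPeriodRat = plusPeriod f →
          ∀ (Lplus Lminus : IwasawaAlgebra 2), IsPollackPair f 2 Lplus Lminus →
          ∀ [ContinuousSMul ℤ_[2] (W.tateModule 2)] [Module.Free ℤ_[2] (W.tateModule 2)]
            [Module.Finite ℤ_[2] (W.tateModule 2)],
          ∀ 𝔭 : PrimeSpectrum (IwasawaAlgebra 2), 𝔭.asIdeal.height = 1 →
            PowerSeries.C (2 : ℤ_[2]) ∉ 𝔭.asIdeal →
          ∀ (I : Kato2004.IwasawaH1Data W 2 κ γ)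
            (pair : ∀ n : ℕ, H1 (tateRep W 2) (κ.layerSubgroup n) →ₗ[ℤ_[2]]
              (localLayerPointsOfEmb κ (closureEmb (K := ℚ) (v.adicCompletion ℚ)) W n →+ ℤ_[2])),
            -- (P1) projection formula
            (∀ (n : ℕ) (x : H1 (tateRep W 2) (κ.layerSubgroup (n + 1))) (Q : localPoints W (v.adicCompletion ℚ))
              (hQ : Q ∈ localLayerPointsOfEmb κ (closureEmb (K := ℚ) (v.adicCompletion ℚ)) W n),
              pair n (layerCores (tateRep W 2) κ n x) ⟨Q, hQ⟩ =
                pair (n + 1) x ⟨Q, localLayerPointsOfEmb_mono κ (closureEmb (K := ℚ) (v.adicCompletion ℚ)) W (Nat.le_succ n) hQ⟩) →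
            -- (P2) Galois invariance, for EVERY `g ∈ Γ_v`
            (∀ (n : ℕ) (g : absoluteGaloisGroup (v.adicCompletion ℚ)) (y : H1 (tateRep W 2) (κ.layerSubgroup n))
              (Q : localPoints W (v.adicCompletion ℚ))
              (hQ : Q ∈ localLayerPointsOfEmb κ (closureEmb (K := ℚ) (v.adicCompletion ℚ)) W n),
              pair n (conjMap (tateRep W 2).toTopRep (κ.layerSubgroup n) (resGalOfEmb (closureEmb (K := ℚ) (v.adicCompletion ℚ)) g) 1 y)
                ⟨g • Q, smul_mem_localLayerPointsOfEmb κ (closureEmb (K := ℚ) (v.adicCompletion ℚ)) W n g hQ⟩ = pair n y ⟨Q, hQ⟩) →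
            -- (P3) `pair` IS the `T₂E`-adic local Tate pairing: residues = the (D-layer) pairings for THE Weil pairings of the tree
            (∀ (n k : ℕ) (x : H1 (tateRep W 2) (κ.layerSubgroup n))
              (Q : localLayerPointsOfEmb κ (closureEmb (K := ℚ) (v.adicCompletion ℚ)) W n),
              PadicInt.toZModPow k (pair n x Q) =
                LayerPairing.layerPairingPk W κ v (LayerPairing.weilTowerPk W) (LayerPairing.weilTowerPk_pow W)
                  (LayerPairing.weilTowerPk_add_left W) (LayerPairing.weilTowerPk_add_right W) (LayerPairing.weilTowerPk_smul W)
                  n k x Q) →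
          ∃ (g : absoluteGaloisGroup (v.adicCompletion ℚ))
            (_ : κ.IsTopGenerator (resGalOfEmb (closureEmb (K := ℚ) (v.adicCompletion ℚ)) g))
            (d : ℕ → localPoints W (v.adicCompletion ℚ)) (s : I.H),
            (∀ n, d n ∈ localLayerPointsOfEmb κ (closureEmb (K := ℚ) (v.adicCompletion ℚ)) W n) ∧
            (∀ n, localTraceOfEmb κ (closureEmb (K := ℚ) (v.adicCompletion ℚ)) W (n + 1) (n + 2) (d (n + 2)) = -d n) ∧
            (∀ n : ℕ, 1 ≤ n → ∀ P ∈ localLayerPointsOfEmb κ (closureEmb (K := ℚ) (v.adicCompletion ℚ)) W n,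
              ∃ B ∈ AddSubgroup.closure (Set.range fun σ : absoluteGaloisGroup (v.adicCompletion ℚ) ↦ σ • d n),
                ∃ P' ∈ localLayerPointsOfEmb κ (closureEmb (K := ℚ) (v.adicCompletion ℚ)) W (n - 1),
                ∃ R ∈ localLayerPointsOfEmb κ (closureEmb (K := ℚ) (v.adicCompletion ℚ)) W n, P = B + P' + 2 • R) ∧
            (∀ P ∈ localLayerPointsOfEmb κ (closureEmb (K := ℚ) (v.adicCompletion ℚ)) W 0,
              ∃ a : ℤ, ∃ R ∈ localLayerPointsOfEmb κ (closureEmb (K := ℚ) (v.adicCompletion ℚ)) W 0, P = a • d 0 + 2 • R) ∧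
            Kato2004.IsEulerSystemClassTwo W hκ I s ∧
            (∀ col₀ : I.H →+ (localTowerPointsOfEmb κ (closureEmb (K := ℚ) (v.adicCompletion ℚ)) W →+ ℤ_[2]),
              (∀ (n : ℕ) (x : I.H) (Q : localPoints W (v.adicCompletion ℚ)) (hQ : Q ∈ localLayerPointsOfEmb κ (closureEmb (K := ℚ) (v.adicCompletion ℚ)) W n),
                col₀ x ⟨Q, localLayerPointsOfEmb_le_localTowerPointsOfEmb κ (closureEmb (K := ℚ) (v.adicCompletion ℚ)) W n hQ⟩ = pair n (I.proj n x) ⟨Q, hQ⟩) →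
              ∃ (μ : IwasawaAlgebra 2) (r : ℚ), μ ∉ 𝔭.asIdeal ∧ r ≠ 0 ∧
                ∀ n : ℕ, ∃ (m : ℕ) (q : IwasawaAlgebra 2),
                  PowerSeries.C ((2 : ℚ_[2]) ^ m) *
                      (iwasawaToPowerSeries 2
                          (pairingSum W (localTowerPointsOfEmb κ (closureEmb (K := ℚ) (v.adicCompletion ℚ)) W) g n (d n) (col₀ s)) -
                        iwasawaToPowerSeries 2 μ * PowerSeries.C ((r : ℚ) : ℚ_[2]) *
                          ((mazurTateElement f 2 n).map (algebraMap ℚ ℚ_[2]) : PowerSeries ℚ_[2])) =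
                    iwasawaToPowerSeries 2 (((cyclotomicOmega 2 n).map (Int.castRingHom ℤ_[2]) : PowerSeries ℤ_[2]) * q))) :
    ∀ (v : HeightOneSpectrum (𝓞 ℚ)), ((2 : ℕ) : 𝓞 ℚ) ∈ v.asIdeal →
      ∀ (W : WeierstrassCurve ℚ) [W.IsElliptic] [W.IsGloballyMinimal],
        ¬ W.HasCM → W.analyticRank = 0 → GoodSS W 2 → W.frobeniusTrace 2 = 0 →
        ∀ (κ : ZpExtension ℚ 2) (γ : Field.absoluteGaloisGroup ℚ) (hκ : κ.IsCyclotomic),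
          κ.IsTopGenerator γ → IsCyclotomicVariable 2 γ →
          ∀ [NeZero (W.conductorNorm ℤ)] (f : CuspForm (Gamma0 (W.conductorNorm ℤ)) 2),
            IsNewformOf W f → ∀ (ϖ : ℚ), (ϖ : ℝ) * W.realPeriodRat = plusPeriod f →
          ∀ (Lplus Lminus : IwasawaAlgebra 2), IsPollackPair f 2 Lplus Lminus →
          ∀ [ContinuousSMul ℤ_[2] (W.tateModule 2)] [Module.Free ℤ_[2] (W.tateModule 2)]
            [Module.Finite ℤ_[2] (W.tateModule 2)],
          ∀ 𝔭 : PrimeSpectrum (IwasawaAlgebra 2), 𝔭.asIdeal.height = 1 →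
            PowerSeries.C (2 : ℤ_[2]) ∉ 𝔭.asIdeal →
          ∀ (I : Kato2004.IwasawaH1Data W 2 κ γ)
            (pair : ∀ n : ℕ, H1 (tateRep W 2) (κ.layerSubgroup n) →ₗ[ℤ_[2]]
              (localLayerPointsOfEmb κ (closureEmb (K := ℚ) (v.adicCompletion ℚ)) W n →+ ℤ_[2])),
            -- (P1) projection formula
            (∀ (n : ℕ) (x : H1 (tateRep W 2) (κ.layerSubgroup (n + 1))) (Q : localPoints W (v.adicCompletion ℚ))
              (hQ : Q ∈ localLayerPointsOfEmb κ (closureEmb (K := ℚ) (v.adicCompletion ℚ)) W n),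
              pair n (layerCores (tateRep W 2) κ n x) ⟨Q, hQ⟩ =
                pair (n + 1) x ⟨Q, localLayerPointsOfEmb_mono κ (closureEmb (K := ℚ) (v.adicCompletion ℚ)) W (Nat.le_succ n) hQ⟩) →
            -- (P2) Galois invariance, for EVERY `g ∈ Γ_v`
            (∀ (n : ℕ) (g : absoluteGaloisGroup (v.adicCompletion ℚ)) (y : H1 (tateRep W 2) (κ.layerSubgroup n))
              (Q : localPoints W (v.adicCompletion ℚ))
              (hQ : Q ∈ localLayerPointsOfEmb κ (closureEmb (K := ℚ) (v.adicCompletion ℚ)) W n),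
              pair n (conjMap (tateRep W 2).toTopRep (κ.layerSubgroup n) (resGalOfEmb (closureEmb (K := ℚ) (v.adicCompletion ℚ)) g) 1 y)
                ⟨g • Q, smul_mem_localLayerPointsOfEmb κ (closureEmb (K := ℚ) (v.adicCompletion ℚ)) W n g hQ⟩ = pair n y ⟨Q, hQ⟩) →
            -- (P3) `pair` IS the `T₂E`-adic local Tate pairing: residues = the (D-layer) pairings for THE Weil pairings of the tree
            (∀ (n k : ℕ) (x : H1 (tateRep W 2) (κ.layerSubgroup n))
              (Q : localLayerPointsOfEmb κ (closureEmb (K := ℚ) (v.adicCompletion ℚ)) W n),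
              PadicInt.toZModPow k (pair n x Q) =
                LayerPairing.layerPairingPk W κ v (LayerPairing.weilTowerPk W) (LayerPairing.weilTowerPk_pow W)
                  (LayerPairing.weilTowerPk_add_left W) (LayerPairing.weilTowerPk_add_right W) (LayerPairing.weilTowerPk_smul W)
                  n k x Q) →
          ∃ (g : absoluteGaloisGroup (v.adicCompletion ℚ))
            (_ : κ.IsTopGenerator (resGalOfEmb (closureEmb (K := ℚ) (v.adicCompletion ℚ)) g))
            (d : ℕ → localPoints W (v.adicCompletion ℚ)) (s : I.H),
            (∀ n, d n ∈ localLayerPointsOfEmb κ (closureEmb (K := ℚ) (v.adicCompletion ℚ)) W n) ∧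
            (∀ n, localTraceOfEmb κ (closureEmb (K := ℚ) (v.adicCompletion ℚ)) W (n + 1) (n + 2) (d (n + 2)) = -d n) ∧
            (∀ n : ℕ, 1 ≤ n → ∀ P ∈ localLayerPointsOfEmb κ (closureEmb (K := ℚ) (v.adicCompletion ℚ)) W n,
              ∃ B ∈ AddSubgroup.closure (Set.range fun σ : absoluteGaloisGroup (v.adicCompletion ℚ) ↦ σ • d n),
                ∃ P' ∈ localLayerPointsOfEmb κ (closureEmb (K := ℚ) (v.adicCompletion ℚ)) W (n - 1),
                ∃ R ∈ localLayerPointsOfEmb κ (closureEmb (K := ℚ) (v.adicCompletion ℚ)) W n, P = B + P' + 2 • R) ∧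
            (∀ P ∈ localLayerPointsOfEmb κ (closureEmb (K := ℚ) (v.adicCompletion ℚ)) W 0,
              ∃ a : ℤ, ∃ R ∈ localLayerPointsOfEmb κ (closureEmb (K := ℚ) (v.adicCompletion ℚ)) W 0, P = a • d 0 + 2 • R) ∧
            Kato2004.IsEulerSystemClassTwo W hκ I s ∧
            (∀ col₀ : I.H →+ (localTowerPointsOfEmb κ (closureEmb (K := ℚ) (v.adicCompletion ℚ)) W →+ ℤ_[2]),
              (∀ (n : ℕ) (x : I.H) (Q : localPoints W (v.adicCompletion ℚ)) (hQ : Q ∈ localLayerPointsOfEmb κ (closureEmb (K := ℚ) (v.adicCompletion ℚ)) W n),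
                col₀ x ⟨Q, localLayerPointsOfEmb_le_localTowerPointsOfEmb κ (closureEmb (K := ℚ) (v.adicCompletion ℚ)) W n hQ⟩ = pair n (I.proj n x) ⟨Q, hQ⟩) →
              ∀ Ls Lf : IwasawaAlgebra 2, IsColemanPair κ (closureEmb (K := ℚ) (v.adicCompletion ℚ)) W 0 g d (col₀ s) Ls Lf →
                lengthAt (IwasawaAlgebra 2) (IwasawaAlgebra 2 ⧸ Ideal.span {Lf}) 𝔭 ≤
                  lengthAt (IwasawaAlgebra 2) (IwasawaAlgebra 2 ⧸ Ideal.span {kobayashiL 1 Lplus Lminus}) 𝔭) := by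
  intro v hv W _ _ hCM hr0 hss ha2 κ γ hκ hγ hcyc _ f hf ϖ hϖ Lplus Lminus hPP _ _ _ 𝔭 h𝔭 h2𝔭 I pair hP1 hP2 hP3
  obtain ⟨g, hg, d, s, hL, hTR, hGEN, hGEN0, hES, hMTV⟩ :=
    hmtv v hv W hCM hr0 hss ha2 κ γ hκ hγ hcyc f hf ϖ hϖ Lplus Lminus hPP 𝔭 h𝔭 h2𝔭 I pair hP1 hP2 hP3
  refine ⟨g, hg, d, s, hL, hTR, hGEN, hGEN0, hES, fun col₀ hglue Ls Lf hcol ↦ ?_⟩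
  obtain ⟨μ, r, hμ, hr, hMT⟩ := hMTV col₀ hglue
  exact (lengthAt_flat_eq_of_isPollackPair_of_mtValues κ (closureEmb (K := ℚ) (v.adicCompletion ℚ)) W f hPP 𝔭 h2𝔭
    hμ hr hMT hcol).le

end Core

end Summit.BirchSwinnertonDyer.BirchSwinnertonDyer.Theorems.SignedKatoOffTwo.MTValues

end
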